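import Mathlib
import Summits.BirchSwinnertonDyer.BirchSwinnertonDyer.Theorems.OneSidedTwistSqueezeX9KatoDivisibilityX9ULedgerDefs

set_option autoImplicit false

-- the summit and its single problem are both named `BirchSwinnertonDyer` (registry layout D-0017)
set_option linter.dupNamespace false

/-!
# `2 × 2` nilpotent kernels: unimodular square-zero cokernels and the normal form of a square-zero matrix
# over a factorial domain (helpers for crux stmt-BirchSwinnertonDyer-20547 `KatoDivisibilityX9`, stub 3 (U))

Mathlib-only lemmas about the matrices `nilMat h = (0 h; 0 0)` and `outerNil e₁ e₂ = e · (−e₂, e₁)` of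
`…ULedgerDefs.lean`, ported verbatim from the bsd-f3-mu cell's kernel-checked sketch `Sketch71.lean` v5
f376123484d02b28 (planner-bsd-f3-mu-desc g71, §A and §D; port plan PORT-PLAN-72 file P1, desc g72):

* `nilMat_mulVec`; `mem_range_of_prime_smul_mem`, `coker_torsionFree_of_unimodular` — CASE (a) OF LEMMA 71.2: over a
  domain, for a prime element `ϖ ∤ h`, the cokernel of a conjugate `B · nilMat h · B⁻¹` has no `ϖ`-torsion
  (UNIMODULAR monodromy ⟹ no torsion in the coinvariants at the prime `(ϖ)`);
* `outerNil_mul_self`, `conj_nilMat_eq`, `basis_mul_adj`, `exists_normalForm` — LEMMA 71.2 (normal form): over a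
  factorial domain every square-zero `2 × 2` matrix is `h • outerNil e₁ e₂` with `e₁, e₂` relatively prime; the
  direction `e` is PRIMITIVE but need not be unimodular (`e = (−p, X)` over `ℤ_p⟦X⟧`: Fouquet–Ochiai 2012, Rem. 2.17's
  matrix `(1 − pX, −p²; X², 1 + pX) = 1 + (−1) • outerNil (−p) X` is the failure mode these hypotheses exclude).

Folklore linear algebra; no ledger item is closed here.
-/

open scoped Classical
open Matrix Finset

noncomputable section

namespace Summit.BirchSwinnertonDyer.BirchSwinnertonDyer.Theorems.OneSidedTwistSqueezeX9KatoDivisibilityX9ULedger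

section Nilpotent

variable {R : Type*} [CommRing R]

/-- `N(h) · z = (h z₁, 0)`. [folklore] -/
@[simp] theorem nilMat_mulVec (h : R) (z : Fin 2 → R) : nilMat h *ᵥ z = ![h * z 1, 0] := by
  ext i
  fin_cases i <;> simp [nilMat, Matrix.mulVec, dotProduct, Fin.sum_univ_two]

/-- **Case (a) of Lemma 71.2 (UNIMODULAR monodromy ⟹ no `ϖ`-torsion in the coinvariants).**  Over a domain, for a
prime element `ϖ ∤ h` and an invertible change of basis `B`, the cokernel of `ν = B · N(h) · B⁻¹` on `R²` has no
`ϖ`-torsion: `ϖ • x ∈ range ν ⟹ x ∈ range ν`. [folklore] -/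
theorem mem_range_of_prime_smul_mem [IsDomain R] (ϖ h : R) (hϖ : Prime ϖ) (hh : ¬ ϖ ∣ h)
    (B B' : Matrix (Fin 2) (Fin 2) R) (hB : B * B' = 1) (hB' : B' * B = 1) (x : Fin 2 → R)
    (hx : ϖ • x ∈ LinearMap.range (Matrix.mulVecLin (B * nilMat h * B'))) :
    x ∈ LinearMap.range (Matrix.mulVecLin (B * nilMat h * B')) := by
  obtain ⟨y, hy⟩ := hx
  rw [Matrix.mulVecLin_apply] at hy
  -- transport to the basis `B`: `N(h) (B' y) = ϖ • (B' x)`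
  set z : Fin 2 → R := B' *ᵥ y with hz
  set x' : Fin 2 → R := B' *ᵥ x with hx'
  have hN : nilMat h *ᵥ z = ϖ • x' := by
    calc nilMat h *ᵥ z = (B' * B) *ᵥ (nilMat h *ᵥ (B' *ᵥ y)) := by rw [hB', Matrix.one_mulVec]
      _ = B' *ᵥ ((B * nilMat h * B') *ᵥ y) := by simp only [← Matrix.mulVec_mulVec]
      _ = ϖ • x' := by rw [hy, Matrix.mulVec_smul]
  rw [nilMat_mulVec] at hN
  have h0 : h * z 1 = ϖ * x' 0 := by
    have := congrFun hN 0; simpa using this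
  have h1 : ϖ * x' 1 = 0 := by
    have := congrFun hN 1; simpa using this.symm
  have hx'1 : x' 1 = 0 := by
    rcases mul_eq_zero.mp h1 with h | h
    · exact absurd h hϖ.ne_zero
    · exact h
  -- `ϖ ∣ h · z₁`, `ϖ ∤ h` ⟹ `z₁ = ϖ w`, and then `x'₀ = h w`
  have hdvd : ϖ ∣ z 1 := by
    have : ϖ ∣ h * z 1 := ⟨x' 0, by rw [h0]⟩
    exact (hϖ.dvd_or_dvd this).resolve_left hh
  obtain ⟨w, hw⟩ := hdvd
  have hx'0 : x' 0 = h * w := by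
    have : ϖ * x' 0 = ϖ * (h * w) := by rw [← h0, hw]; ring
    exact mul_left_cancel₀ hϖ.ne_zero this
  have hx'eq : x' = nilMat h *ᵥ ![0, w] := by
    rw [nilMat_mulVec]
    ext i
    fin_cases i
    · simpa using hx'0
    · simpa using hx'1
  -- back to the original basis
  refine ⟨B *ᵥ ![0, w], ?_⟩
  rw [Matrix.mulVecLin_apply]
  have hxB : x = B *ᵥ x' := by
    rw [hx', Matrix.mulVec_mulVec, hB, Matrix.one_mulVec]
  rw [hxB, hx'eq]
  simp only [← Matrix.mulVec_mulVec]
  rw [Matrix.mulVec_mulVec _ B' B, hB', Matrix.one_mulVec]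

/-- Quotient form of `mem_range_of_prime_smul_mem`: the cokernel of a unimodular square-zero `ν` has no non-zero
element killed by the principal prime ideal `(ϖ)`, `ϖ ∤ h`. [folklore] -/
theorem coker_torsionFree_of_unimodular [IsDomain R] (ϖ h : R) (hϖ : Prime ϖ) (hh : ¬ ϖ ∣ h)
    (B B' : Matrix (Fin 2) (Fin 2) R) (hB : B * B' = 1) (hB' : B' * B = 1)
    (S : Submodule R (Fin 2 → R)) (hS : S = LinearMap.range (Matrix.mulVecLin (B * nilMat h * B')))
    (m : (Fin 2 → R) ⧸ S) (hm : ∀ a ∈ Ideal.span {ϖ}, a • m = 0) : m = 0 := by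
  induction m using Submodule.Quotient.induction_on with
  | H x =>
    have hϖm : ϖ • Submodule.Quotient.mk (p := S) x = 0 := hm ϖ (Ideal.mem_span_singleton_self ϖ)
    rw [← Submodule.Quotient.mk_smul, Submodule.Quotient.mk_eq_zero] at hϖm
    rw [Submodule.Quotient.mk_eq_zero]
    subst hS
    exact mem_range_of_prime_smul_mem ϖ h hϖ hh B B' hB hB' x hϖm

end Nilpotent

/-! ## Normal form of a square-zero `2 × 2` matrix over a factorial domain -/

section NormalForm

variable {R : Type*} [CommRing R]

/-- `outerNil e₁ e₂` is square-zero. [folklore] -/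
theorem outerNil_mul_self (e₁ e₂ : R) : outerNil e₁ e₂ * outerNil e₁ e₂ = 0 := by
  ext i j
  fin_cases i <;> fin_cases j <;> simp [outerNil, Matrix.mul_apply, Fin.sum_univ_two] <;> ring

/-- Conjugating the elementary nilpotent `N(h)` by `[e | f]` (adjugate as inverse) gives `h • outerNil e₁ e₂`,
whatever the second column `f`. [folklore] -/
theorem conj_nilMat_eq (e₁ e₂ f₁ f₂ h : R) :
    !![e₁, f₁; e₂, f₂] * nilMat h * !![f₂, -f₁; -e₂, e₁] = h • outerNil e₁ e₂ := by
  ext i j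
  fin_cases i <;> fin_cases j <;> simp [outerNil, nilMat, Matrix.mul_apply, Fin.sum_univ_two] <;> ring

/-- `[e | f]` times its adjugate is `1` on both sides when `det [e | f] = 1`. [folklore] -/
theorem basis_mul_adj (e₁ e₂ f₁ f₂ : R) (hdet : e₁ * f₂ - e₂ * f₁ = 1) :
    !![e₁, f₁; e₂, f₂] * !![f₂, -f₁; -e₂, e₁] = 1 ∧ !![f₂, -f₁; -e₂, e₁] * !![e₁, f₁; e₂, f₂] = 1 := by
  constructor <;>
  · ext i j
    fin_cases i <;> fin_cases j <;> simp [Matrix.mul_apply, Fin.sum_univ_two] <;>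
      first | ring1 | linear_combination hdet

/-- **LEMMA 71.2 (normal form).**  Over a factorial domain, a `2 × 2` matrix with `ν² = 0` is
`h • outerNil e₁ e₂` with `e₁, e₂` relatively prime (the direction `e` is PRIMITIVE; it need not be
unimodular: `e = (−p, X)` over `ℤ_p⟦X⟧`). [folklore] -/
theorem exists_normalForm [IsDomain R] [UniqueFactorizationMonoid R] (ν : Matrix (Fin 2) (Fin 2) R)
    (hν : ν * ν = 0) : ∃ h e₁ e₂ : R, IsRelPrime e₁ e₂ ∧ ν = h • outerNil e₁ e₂ := by
  have h00 : ν 0 0 * ν 0 0 + ν 0 1 * ν 1 0 = 0 := by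
    have := congrArg (fun M : Matrix (Fin 2) (Fin 2) R => M 0 0) hν
    simpa [Matrix.mul_apply, Fin.sum_univ_two] using this
  have h01 : ν 0 0 * ν 0 1 + ν 0 1 * ν 1 1 = 0 := by
    have := congrArg (fun M : Matrix (Fin 2) (Fin 2) R => M 0 1) hν
    simpa [Matrix.mul_apply, Fin.sum_univ_two] using this
  have h11 : ν 1 0 * ν 0 1 + ν 1 1 * ν 1 1 = 0 := by
    have := congrArg (fun M : Matrix (Fin 2) (Fin 2) R => M 1 1) hν
    simpa [Matrix.mul_apply, Fin.sum_univ_two] using this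
  by_cases hb : ν 0 1 = 0
  · -- then `a² = d² = 0`, `ν = (0 0; c 0) = (−c) • outerNil 0 1`
    have ha : ν 0 0 = 0 := by
      rw [hb, zero_mul, add_zero] at h00
      exact mul_self_eq_zero.mp h00
    have hd : ν 1 1 = 0 := by
      rw [hb, mul_zero, zero_add] at h11
      exact mul_self_eq_zero.mp h11
    refine ⟨-(ν 1 0), 0, 1, isRelPrime_one_right, ?_⟩
    ext i j
    fin_cases i <;> fin_cases j <;> simp [outerNil, ha, hb, hd]
  · -- `b ≠ 0`: `d = −a`, and coprime reduction of `(a, b)` in the factorial domain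
    have had : ν 0 0 + ν 1 1 = 0 := by
      have hmul : ν 0 1 * (ν 0 0 + ν 1 1) = 0 := by linear_combination h01
      rcases mul_eq_zero.mp hmul with h | h
      · exact absurd h hb
      · exact h
    obtain ⟨a', b', c', hrel, ha', hb'⟩ :=
      UniqueFactorizationMonoid.exists_reduced_factors' (ν 0 0) (ν 0 1) hb
    have hc'0 : c' ≠ 0 := by
      rintro rfl
      exact hb (by rw [← hb', zero_mul])
    have hb'0 : b' ≠ 0 := by
      rintro rfl
      exact hb (by rw [← hb', mul_zero])
    -- `c'·a'² = b'·(−c)` after cancelling `c'` in `a² + b c = 0`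
    have hkey : c' * (a' * a') = b' * (-(ν 1 0)) := by
      have h1 : c' * (c' * (a' * a') - b' * (-(ν 1 0))) = 0 := by
        have h2 := h00
        rw [← ha', ← hb'] at h2
        linear_combination h2
      rcases mul_eq_zero.mp h1 with h | h
      · exact absurd h hc'0
      · exact sub_eq_zero.mp h
    have hdvd : b' ∣ c' * (a' * a') := ⟨-(ν 1 0), hkey⟩
    have hrel' : IsRelPrime b' (a' * a') := hrel.symm.mul_right hrel.symm
    obtain ⟨g, hg⟩ := hrel'.dvd_of_dvd_mul_right hdvd
    have hc : ν 1 0 = -(g * (a' * a')) := by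
      have h2 : b' * (g * (a' * a') + ν 1 0) = 0 := by
        rw [hg] at hkey
        linear_combination hkey
      rcases mul_eq_zero.mp h2 with h | h
      · exact absurd h hb'0
      · linear_combination h
    refine ⟨g, b', -a', ?_, ?_⟩
    · intro d hd1 hd2
      exact hrel.symm hd1 (dvd_neg.mp hd2)
    · ext i j
      fin_cases i <;> fin_cases j <;> simp [outerNil]
      · linear_combination (-1 : R) * ha' + a' * hg
      · linear_combination (-1 : R) * hb' + b' * hg
      · linear_combination hc
      · linear_combination had + ha' - a' * hg

end NormalForm

end Summit.BirchSwinnertonDyer.BirchSwinnertonDyer.Theorems.OneSidedTwistSqueezeX9KatoDivisibilityX9ULedger
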